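import Literature.MathematicalPhysics.QuantumFieldTheory.Balaban1983to89.B13TermWalkDataOneTorus

/-!
# Spine/NE5/TwoRunTorusNE5Windows — the per-scale constant packages of the END theorem EXIST with scale-independent
# letters: only the configuration radius (∝ the window `s∕θ^j`) and the σ-distance grow (cell `pub-balaban-gaps`, seat `ne5` gen 11)

WHY.  T37 §2 `TwoRunTorusNE5Terms.ne5_of_termWalkData_all_scales` asks, per creation scale `j`, for ONE constant package
`w j : WalkConsts` admissible at a configuration size `α j` with `1 < α j` and `s∕θ^j ≤ α j` wherever `θ^j < s`, carrying
NODE A's smallness `SmallTheta (w j) (α j) ϑ` with a COMMON `ϑ`, while the envelope letters of the chain (`K̄_Γ, K̄_E, K̄_C`,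
the torus rate `κ`, the drop `ε`) must NOT depend on `j` (the (2.41) constant `A₂C₃ε₁` and NE5's `C₅ = 2A₂C₃ε₁∕s` are
scale-independent).  THIS FILE records that these requirements are jointly consistent and says exactly what grows:
`windows_of_thresholds` — for any non-negative letters `K̄_Γ, K̄_E, K̄_C`, any `ε > 0`, `κ > 0`, `ϑ > 0`, any rate `θ`, margin
`s` and σ-distance floor `Rσ₀`, the packages `w j := ⟨R_j, ε, κ, K̄_Γ, K̄_E, K̄_C, R_σ⟩` with
`α j := max 2 (s∕θ^j)`, `R_j := α j · (8(K+1)∕ϑ + 2)` (`K := max K̄_Γ K̄_E`) and `R_σ := max Rσ₀ (log(8(K+1)∕ϑ)∕ε)` satisfy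
ALL of §2's package-side binders at every scale (`Admissible`, `1 < α j`, the window, `SmallTheta`, letters and rate equal
to the given ones), with the decay ∕ reach number `e^{−εR_σ} + α j∕R_j ≤ ϑ∕(4(K+1))` uniformly in `j` (the small parameter of
T34's threshold form, so the remaining p. 17 numerics of §2 close uniformly in the scale as well).  READING (gate (b) of row NE5 made quantitative on the consumer side): what NODE O must deliver per
scale is a walk record of the two-run PENCIL kernels analytic on a configuration ball of radius `R_j = O(s∕θ^j)` with
j-independent majorant constants — i.e. exactly the primitive two-run rate of rows NE2∕NE3 (run A's and run B's kernels
`θ^j`-close in walk-weighted currency, cf. gen 5's `TwoRunPencilWalks.jointWalkExpansion_pencil_reach`: constants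
×(1 + R_j·r_j) stay bounded iff `r_j = O(θ^j)`); nothing else in the package grows.

HONEST FRAMING.  Elementary real-number bookkeeping over the LANDED hypothesis shapes `WalkConsts.Admissible` and
`SmallTheta` (g1-p2's `B13TermWalkData(OneTorus)`); it shows the package-side binders of T37 §2 are satisfiable with
scale-independent letters, NOT that Bałaban's operators admit such records (NODE O's statement (v), instance 0∕1) and NOT
the two-run rate (rows NE2∕NE3); NE5 NOT PRINTED ∕ NOT PROVED; leaves 0∕12; (D4) 0∕1; spine 0∕9.  Rung (B)+1 on a FIXED
finite T⁴ — NOT continuum, NOT infinite volume, NOT mass gap, NOT Clay.  0 sorry, 0 `def`.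

Sources: [II] = T. Bałaban, CMP **116** (1988) [Balaban1988RG2Cluster] (1.11) p. 5, p. 13, p. 15 (the bigger analyticity
space `α′₀, α′₁`), (2.16) p. 16, p. 17 («α₅ sufficiently small»); [B9] = CMP **99** (1985) [Balaban1985BackgroundPropagators]
(3.108) p. 416; C. King, CMP **102** (1986) [King1986] p. 665.  Nothing here is a claim about the Yang–Mills mass gap.
-/

noncomputable section

namespace Summit.QuantumFields.BalabanUV.T4Continuum.Spine.NE5.TwoRunTorusNE5Windows

open Literature.MathematicalPhysics.QuantumFieldTheory.Balaban1983to89.B13TermWalkData (WalkConsts)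
open Literature.MathematicalPhysics.QuantumFieldTheory.Balaban1983to89.B13TermWalkDataOneTorus (SmallTheta)

/-- Elementary: if `K' ≤ K`, `0 ≤ K`, `0 ≤ x, y ≤ ϑ∕(8(K+1))` then `2K'(x + y) ≤ ϑ`. [folklore] -/
theorem two_mul_le_of_eighth {K K' x y ϑ : ℝ} (hK : 0 ≤ K) (hK'K : K' ≤ K) (hϑ : 0 ≤ ϑ)
    (hx0 : 0 ≤ x) (hy0 : 0 ≤ y) (hx : x ≤ ϑ / (8 * (K + 1))) (hy : y ≤ ϑ / (8 * (K + 1))) :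
    2 * K' * (x + y) ≤ ϑ := by
  have hK1 : 0 < 8 * (K + 1) := by positivity
  set t := ϑ / (8 * (K + 1)) with ht
  have ht0 : 0 ≤ t := div_nonneg hϑ hK1.le
  have hϑt : 8 * (K + 1) * t = ϑ := by rw [ht]; field_simp
  calc 2 * K' * (x + y) ≤ 2 * K * (t + t) := by gcongr
    _ = 4 * K * t := by ring
    _ ≤ 8 * (K + 1) * t := by nlinarith
    _ = ϑ := hϑt

/-- Elementary: with `R_σ ≥ log(8(K+1)∕ϑ)∕ε` (`ε, ϑ > 0`, `K ≥ 0`) the σ-decay number obeys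
`e^{−εR_σ} ≤ ϑ∕(8(K+1))`. [folklore] -/
theorem exp_neg_le_of_log_le {K ε ϑ Rσ : ℝ} (hK : 0 ≤ K) (hε : 0 < ε) (hϑ : 0 < ϑ)
    (hRσ : Real.log (8 * (K + 1) / ϑ) / ε ≤ Rσ) :
    Real.exp (-(ε * Rσ)) ≤ ϑ / (8 * (K + 1)) := by
  have hM : 0 < 8 * (K + 1) / ϑ := by positivity
  have h1 : Real.log (8 * (K + 1) / ϑ) ≤ ε * Rσ := by
    have := (div_le_iff₀ hε).1 hRσ
    linarith [mul_comm Rσ ε]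
  calc Real.exp (-(ε * Rσ)) ≤ Real.exp (-Real.log (8 * (K + 1) / ϑ)) :=
        Real.exp_le_exp.2 (neg_le_neg h1)
    _ = (8 * (K + 1) / ϑ)⁻¹ := by rw [Real.exp_neg, Real.exp_log hM]
    _ = ϑ / (8 * (K + 1)) := by rw [inv_div]

/-- Elementary: with `R = α(8(K+1)∕ϑ + 2)` (`α, ϑ > 0`, `K ≥ 0`) the configuration ratio obeys `α∕R ≤ ϑ∕(8(K+1))`
and `α < R`. [folklore] -/
theorem ratio_le_of_radius {K ϑ α : ℝ} (hK : 0 ≤ K) (hϑ : 0 < ϑ) (hα : 0 < α) :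
    α / (α * (8 * (K + 1) / ϑ + 2)) ≤ ϑ / (8 * (K + 1)) ∧ α < α * (8 * (K + 1) / ϑ + 2) := by
  have hM : 0 < 8 * (K + 1) / ϑ := by positivity
  refine ⟨?_, ?_⟩
  · rw [div_mul_eq_div_div, div_self hα.ne']
    calc 1 / (8 * (K + 1) / ϑ + 2) ≤ 1 / (8 * (K + 1) / ϑ) :=
          one_div_le_one_div_of_le hM (by linarith)
      _ = ϑ / (8 * (K + 1)) := by rw [one_div, inv_div]
  · have : (1 : ℝ) < 8 * (K + 1) / ϑ + 2 := by linarith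
    calc α = α * 1 := (mul_one α).symm
      _ < α * (8 * (K + 1) / ϑ + 2) := mul_lt_mul_of_pos_left this hα

/-- **THE PER-SCALE PACKAGES OF T37 §2 EXIST WITH SCALE-INDEPENDENT LETTERS** (what grows with the scale is only the
configuration radius, proportional to the window `s∕θ^j`, and — once — the σ-distance).  For all non-negative
`K̄_Γ, K̄_E, K̄_C`, all `ε > 0`, `κ > 0`, `ϑ > 0` and every rate `θ`, margin `s`, floor `Rσ₀` there are packages `w j` and sizes
`α j` with, at EVERY scale `j`: `(w j).Admissible (α j) Rσ₀`; `1 < α j`; `θ^j < s → s∕θ^j ≤ α j`; `SmallTheta (w j) (α j) ϑ`;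
the letters `K̄_Γ, K̄_E, K̄_C`, the rate `κ` and the drop `ε` of `w j` EQUAL to the given ones; and the radius bound
`(w j).R ≤ max 2 (s∕θ^j) · (8(max K̄_Γ K̄_E + 1)∕ϑ + 2)` — `R_j = O(s∕θ^j)`; and the package's decay ∕ reach number is
uniformly small, `e^{−εR_σ} + α j∕R_j ≤ ϑ∕(4(max K̄_Γ K̄_E + 1))` at every scale (the small parameter of T34
`TwoRunTorusWalkNumerics.numerics_of_thresholds` (3), so the p. 17 numerics close uniformly in `j`).  (Witness: `α j = max 2 (s∕θ^j)`,
`R_j = α j·(8(K+1)∕ϑ + 2)`, `R_σ = max Rσ₀ (log(8(K+1)∕ϑ)∕ε)`, `K = max K̄_Γ K̄_E`.)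
[cite: Balaban1988RG2Cluster, (1.11) p.5, p.15, (2.16) p.16, p.17; Balaban1985BackgroundPropagators, (3.108) p.416; King1986, p.665] -/
theorem windows_of_thresholds {KΓ KE KC ε κ ϑ : ℝ} (θ s Rσ₀ : ℝ) (hKΓ : 0 ≤ KΓ) (hKE : 0 ≤ KE) (hKC : 0 ≤ KC)
    (hε : 0 < ε) (hκ : 0 < κ) (hϑ : 0 < ϑ) :
    ∃ (w : ℕ → WalkConsts) (α : ℕ → ℝ),
      (∀ j, (w j).Admissible (α j) Rσ₀) ∧ (∀ j, 1 < α j) ∧ (∀ j, θ ^ j < s → s / θ ^ j ≤ α j) ∧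
      (∀ j, SmallTheta (w j) (α j) ϑ) ∧
      (∀ j, (w j).KbarΓ = KΓ ∧ (w j).KbarE = KE ∧ (w j).KbarC = KC ∧ (w j).kap = κ ∧ (w j).ε = ε) ∧
      (∀ j, (w j).R ≤ max 2 (s / θ ^ j) * (8 * (max KΓ KE + 1) / ϑ + 2)) ∧
      (∀ j, Real.exp (-((w j).ε * (w j).Rσ)) + α j / (w j).R ≤ ϑ / (4 * (max KΓ KE + 1))) := by
  set K := max KΓ KE with hKdef
  have hK : 0 ≤ K := hKΓ.trans (le_max_left _ _)
  set Rσ := max Rσ₀ (Real.log (8 * (K + 1) / ϑ) / ε) with hRσdef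
  let α : ℕ → ℝ := fun j => max 2 (s / θ ^ j)
  have hα2 : ∀ j, (2 : ℝ) ≤ α j := fun j => le_max_left _ _
  have hα0 : ∀ j, 0 < α j := fun j => two_pos.trans_le (hα2 j)
  let w : ℕ → WalkConsts := fun j =>
    { R := α j * (8 * (K + 1) / ϑ + 2), ε := ε, kap := κ, KbarΓ := KΓ, KbarE := KE, KbarC := KC, Rσ := Rσ }
  have hexp : Real.exp (-(ε * Rσ)) ≤ ϑ / (8 * (K + 1)) :=
    exp_neg_le_of_log_le hK hε hϑ (le_max_right _ _)
  have hexp0 : 0 ≤ Real.exp (-(ε * Rσ)) := (Real.exp_pos _).le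
  refine ⟨w, α, fun j => ?_, fun j => one_lt_two.trans_le (hα2 j), fun j _ => le_max_right _ _, fun j => ?_,
    fun j => ⟨rfl, rfl, rfl, rfl, rfl⟩, fun j => le_rfl, fun j => ?_⟩
  · -- admissibility at size `α j` and floor `Rσ₀`
    exact { hαR := (ratio_le_of_radius hK hϑ (hα0 j)).2, hε := hε.le, hkap := hκ, hKbarΓ := hKΓ, hKbarE := hKE,
            hKbarC := hKC, hRσ := le_max_left _ _ }
  · -- NODE A's smallness with the common `ϑ`
    have hrat := (ratio_le_of_radius hK hϑ (hα0 j)).1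
    have hrat0 : 0 ≤ α j / (α j * (8 * (K + 1) / ϑ + 2)) :=
      div_nonneg (hα0 j).le ((hα0 j).trans (ratio_le_of_radius hK hϑ (hα0 j)).2).le
    exact { hΓ := two_mul_le_of_eighth hK (le_max_left _ _) hϑ.le hexp0 hrat0 hexp hrat,
            hE := two_mul_le_of_eighth hK (le_max_right _ _) hϑ.le hexp0 hrat0 hexp hrat }
  · -- the decay ∕ reach number of the package is uniformly small in the scale (T34's threshold (3) input)
    have hrat := (ratio_le_of_radius hK hϑ (hα0 j)).1
    have hK1 : 0 < 8 * (K + 1) := by positivity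
    calc Real.exp (-(ε * Rσ)) + α j / (α j * (8 * (K + 1) / ϑ + 2))
        ≤ ϑ / (8 * (K + 1)) + ϑ / (8 * (K + 1)) := add_le_add hexp hrat
      _ = ϑ / (4 * (K + 1)) := by field_simp; ring

/-- **COROLLARY — the rate binder too**: with the packages of `windows_of_thresholds` every rate `κ_a < κ` satisfies T37
§2's `hκa : ∀ j, κ_a < (w j).kap`, since `(w j).kap = κ` at every scale. [folklore] -/
theorem rate_binder_of_windows {w : ℕ → WalkConsts} {κ κa : ℝ} (hw : ∀ j, (w j).kap = κ) (hκa : κa < κ) :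
    ∀ j, κa < (w j).kap := fun j => (hw j).symm ▸ hκa

end Summit.QuantumFields.BalabanUV.T4Continuum.Spine.NE5.TwoRunTorusNE5Windows

end
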